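import Literature.Topology.FourManifolds.BCSConstruction
import Literature.Topology.FourManifolds.BordismFourTransitivity
import Literature.Topology.FourManifolds.BordismFourComponents
import Literature.Topology.FourManifolds.NeckConnectedSum
import HarnessLib

/-!
# Merging: `A ⊔ B` is cobordant to the connected sum `A # B`; connected representatives of
# bordism classes

Topic `Literature/Topology/FourManifolds` (fact seat of
`Literature.Topology.FourManifolds.isOrientedBordant_of_isEmpty_of_signature_eq_zero`, Kirby
1989, Cor. IX.2).  Sequel of `BordismFourComponents` (reduction of Cor. IX.2 to CONNECTED `M`,
modulo the merging step).  This file constructs the merging bordism — the geometric content of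
that step — for unoriented bordism, in every dimension `n + 1 ≥ 2` and for manifolds in `Type`:

R. C. Kirby, *The topology of 4-manifolds*, LNM 1374 (1989), Ch. VIII (Thm 1 is stated for
connected `M⁴`; classes of `Ω₄` are represented by connected manifolds because `M₁ ⊔ M₂` is
bordant to `M₁ # M₂` through `(M₁ ⊔ M₂) × I ∪ 1-handle`); J. Milnor, J. Stasheff,
*Characteristic classes* (1974), §17; and, for the boundary connected sum used here in place of
the `1`-handle, M. Kervaire, J. Milnor, *Groups of homotopy spheres I*, Ann. of Math. 77 (1963),
§2, Lemma 2.2: `∂(W₁ ♮ W₂) = ∂W₁ # ∂W₂`.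

Construction.  For closed nonempty `A`, `B` the cylinders `A × I`, `B × I` are null-cobordisms
of the doubles `A ⊔ A`, `B ⊔ B` (`isCobordant_sum_self_of_isEmpty`, from the tree's
`cylinderCobordism`).  Their boundary connected sum at discs of the TOP copies — the tree's
generic `NullCobordism.BCSSetup` (`BCSConstruction.lean`: collar half-discs, Juhász's pushout
`HalfDiscPair.exists_isOpenGluing`, compactness, `BCSSetup.glued`) fed with the connected-sum
data lifted along `inr` (`ConnectedSumData.sumInr`, charts lifted by Mathlib's
`OpenPartialHomeomorph.lift_openEmbedding` stay in the maximal atlas,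
`mem_maximalAtlas_lift_openEmbedding_inr`) and with the glued connected sum
`(A ⊔ A) # (B ⊔ B)` itself as boundary — is a null-cobordism of `(A ⊔ A) # (B ⊔ B)`.  That
manifold is `(A ⊔ B) ⊔ (A # B)`: the split presentation `fA ∘ splitA⁻¹`, `fB ∘ splitB⁻¹` of
`(A ⊔ B) ⊔ (A # B)` as an open gluing of the same punctured pieces along the same relation
(`ConnectedSumData.fA_splitA_symm_eq_iff`) and the uniqueness of open gluings
(`IsOpenGluing.exists_diffeomorph_comp_eq`, Kosinski VI.1.1).  Hence `(A ⊔ B) ⊔ (A # B)` bounds,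
i.e. `A ⊔ B ∼ A # B` (Thom's dictionary `IsCobordant.of_sum_of_isEmpty`), and `A # B` is connected
(`IsConnectedSum.connectedSpace_holds`).

* `exists_isCobordant_sum_connectedSpace` — **for closed connected nonempty `A`, `B : Type` of
  dimension `n + 1 ≥ 2`, `A ⊔ B` is cobordant to a connected closed manifold** (namely `A # B`);
* `exists_connectedSpace_isCobordant` — **every closed nonempty manifold of dimension `≥ 2` is
  cobordant to a connected one** (induction on components, `BordismFourComponents`).

Also proved, general tools: `IsSmoothEmbedding.comp_of_isOpen_range` (a smooth embedding
precomposed with an open smooth embedding is a smooth embedding; Mathlib has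
`proof_wanted IsSmoothEmbedding.comp`), `mem_maximalAtlas_lift_openEmbedding_inr`.

Everything is proved; the only definitions are the explicit constructions `ConnectedSumData.sumInr`,
`splitA/B`, `fA/B` (no named facts).  NOT here: the ORIENTED merging (a relative fundamental class
on `(A × I) ♮ (B × I)` inducing `α ⊔ β` on the untouched copies — the sign of the Kervaire–Milnor
gluing on the `B`-side has to be pinned by the handedness of the disc), which is what the
reduction `isOrientedBordant_of_isEmpty_of_signature_eq_zero_of_connected` consumes.

## References

* R. C. Kirby, *The topology of 4-manifolds*, LNM 1374, Springer (1989), Ch. VIII, Cor. IX.2.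
  [Kirby1989]
* M. A. Kervaire, J. W. Milnor, *Groups of homotopy spheres: I*, Ann. of Math. (2) 77 (1963),
  §2, Lemma 2.2. [KervaireMilnorAnnals1963]
* J. Milnor, J. Stasheff, *Characteristic classes*, Ann. of Math. Studies 76 (1974), §17.
  [MilnorStasheffAMS76]
* R. Thom, *Quelques propriétés globales des variétés différentiables*, Comment. Math. Helv. 28
  (1954), Ch. IV §1. [ThomCMH1954]
* A. Kosinski, *Differential Manifolds* (1993), Ch. VI §1 Thm (1.1), VI.5. [Kosinski1993]
* J. M. Lee, *Introduction to Smooth Manifolds*, 2nd ed. (2013), Prop. 5.2. [LeeSmoothManifolds2013]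
-/

open scoped Manifold ContDiff Topology
open Set Function TopologicalSpace Topology

noncomputable section

namespace Literature.Topology.FourManifolds

universe u

section LiftedCharts

variable {E H : Type*} [NormedAddCommGroup E] [NormedSpace ℝ E] [TopologicalSpace H]
  {I : ModelWithCorners ℝ E H} {M M' : Type u} [TopologicalSpace M] [ChartedSpace H M]
  [TopologicalSpace M'] [ChartedSpace H M'] [IsManifold I ∞ M] [IsManifold I ∞ M']

omit [IsManifold I ∞ M] in
/-- **A chart of the maximal smooth atlas of `M'`, lifted along `inr`, is a chart of the maximal
smooth atlas of `M ⊔ M'`** (the smooth structure of a disjoint union is the disjoint union of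
the smooth structures; cf. Mathlib's `IsManifold.disjointUnion`). [folklore] -/
theorem mem_maximalAtlas_lift_openEmbedding_inr [Nonempty H] {e : OpenPartialHomeomorph M' H}
    (he : e ∈ IsManifold.maximalAtlas I ∞ M') :
    e.lift_openEmbedding IsOpenEmbedding.inr ∈ IsManifold.maximalAtlas I ∞ (M ⊕ M') := by
  rw [IsManifold.mem_maximalAtlas_iff, mem_maximalAtlas_iff]
  intro e' he'
  obtain (⟨f, hf, rfl⟩ | ⟨f, hf, rfl⟩) := ChartedSpace.mem_atlas_sum he'
  · constructor
    · apply ContDiffGroupoid.mem_of_source_eq_empty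
      ext x
      simp only [OpenPartialHomeomorph.trans_source, OpenPartialHomeomorph.symm_source,
        OpenPartialHomeomorph.lift_openEmbedding_target, mem_inter_iff, mem_preimage,
        OpenPartialHomeomorph.lift_openEmbedding_source, mem_image, mem_empty_iff_false,
        iff_false, not_and]
      intro hx ⟨y, _, hy⟩
      rw [OpenPartialHomeomorph.lift_openEmbedding_symm] at hy
      exact Sum.inl_ne_inr hy
    · apply ContDiffGroupoid.mem_of_source_eq_empty
      ext x
      simp only [OpenPartialHomeomorph.trans_source, OpenPartialHomeomorph.symm_source,
        OpenPartialHomeomorph.lift_openEmbedding_target, mem_inter_iff, mem_preimage,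
        OpenPartialHomeomorph.lift_openEmbedding_source, mem_image, mem_empty_iff_false,
        iff_false, not_and]
      intro hx ⟨y, _, hy⟩
      rw [OpenPartialHomeomorph.lift_openEmbedding_symm] at hy
      exact Sum.inr_ne_inl hy
  · constructor
    · rw [e.lift_openEmbedding_trans f IsOpenEmbedding.inr]
      exact IsManifold.compatible_of_mem_maximalAtlas he (IsManifold.subset_maximalAtlas hf)
    · rw [f.lift_openEmbedding_trans e IsOpenEmbedding.inr]
      exact IsManifold.compatible_of_mem_maximalAtlas (IsManifold.subset_maximalAtlas hf) he

end LiftedCharts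

section SumData

variable {d : ℕ} {A A' B B' : Type u}
  [TopologicalSpace A] [ChartedSpace (EuclideanSpace ℝ (Fin d)) A] [IsManifold (𝓡 d) ∞ A]
  [TopologicalSpace A'] [ChartedSpace (EuclideanSpace ℝ (Fin d)) A'] [IsManifold (𝓡 d) ∞ A']
  [TopologicalSpace B] [ChartedSpace (EuclideanSpace ℝ (Fin d)) B] [IsManifold (𝓡 d) ∞ B]
  [TopologicalSpace B'] [ChartedSpace (EuclideanSpace ℝ (Fin d)) B'] [IsManifold (𝓡 d) ∞ B']

/-- **Connected sum data lifted to disjoint unions**: discs `i₁`, `i₂` of `A`, `B` give discs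
`inr ∘ i₁`, `inr ∘ i₂` of `A' ⊔ A`, `B' ⊔ B` (the charts lifted along `inr`). [folklore] -/
def ConnectedSumData.sumInr (D : ConnectedSumData d A B) :
    ConnectedSumData d (A' ⊕ A) (B' ⊕ B) where
  e₁ := D.e₁.lift_openEmbedding IsOpenEmbedding.inr
  e₂ := D.e₂.lift_openEmbedding IsOpenEmbedding.inr
  mem_maximalAtlas₁ := mem_maximalAtlas_lift_openEmbedding_inr D.mem_maximalAtlas₁
  mem_maximalAtlas₂ := mem_maximalAtlas_lift_openEmbedding_inr D.mem_maximalAtlas₂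
  target₁ := by rw [OpenPartialHomeomorph.lift_openEmbedding_target, D.target₁]
  target₂ := by rw [OpenPartialHomeomorph.lift_openEmbedding_target, D.target₂]

omit [IsManifold (𝓡 d) ∞ A'] [IsManifold (𝓡 d) ∞ B'] in
/-- The first lifted disc is `inr ∘ i₁`. [folklore] -/
@[simp] theorem ConnectedSumData.sumInr_i₁ (D : ConnectedSumData d A B) (v : EuclideanSpace ℝ (Fin d)) :
    (D.sumInr (A' := A') (B' := B')).i₁ v = Sum.inr (D.i₁ v) := rfl

omit [IsManifold (𝓡 d) ∞ A'] [IsManifold (𝓡 d) ∞ B'] in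
/-- The second lifted disc is `inr ∘ i₂`. [folklore] -/
@[simp] theorem ConnectedSumData.sumInr_i₂ (D : ConnectedSumData d A B) (v : EuclideanSpace ℝ (Fin d)) :
    (D.sumInr (A' := A') (B' := B')).i₂ v = Sum.inr (D.i₂ v) := rfl

end SumData


/-! ### Composition of open smooth embeddings -/

section CompOpen

variable {E H : Type*} [NormedAddCommGroup E] [NormedSpace ℝ E] [TopologicalSpace H]
  {I : ModelWithCorners ℝ E H} {M M' : Type*} [TopologicalSpace M] [ChartedSpace H M]
  [TopologicalSpace M'] [ChartedSpace H M'] [IsManifold I ∞ M] [IsManifold I ∞ M']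
  {E' H' : Type*} [NormedAddCommGroup E'] [NormedSpace ℝ E'] [TopologicalSpace H']
  {J : ModelWithCorners ℝ E' H'} {N : Type*} [TopologicalSpace N] [ChartedSpace H' N]

/-- **A smooth embedding precomposed with an OPEN smooth embedding is a smooth embedding** (the
open embedding is a globally defined partial diffeomorphism onto its range, Lee 2013, Prop. 5.2;
`IsSmoothEmbedding.comp_openPartialHomeomorph`).  Mathlib has no composition of smooth
embeddings yet (`proof_wanted Manifold.IsSmoothEmbedding.comp`). [folklore] -/
theorem IsSmoothEmbedding.comp_of_isOpen_range {f : M → N} {g : M' → M}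
    (hf : Manifold.IsSmoothEmbedding I J ∞ f) (hg : Manifold.IsSmoothEmbedding I I ∞ g)
    (hgo : IsOpen (range g)) : Manifold.IsSmoothEmbedding I J ∞ (f ∘ g) := by
  rcases isEmpty_or_nonempty M' with hE | hne
  · exact ⟨Manifold.IsImmersionOfComplement.isImmersion (F := Unit) fun x ↦ isEmptyElim x,
      hf.isEmbedding.comp hg.isEmbedding⟩
  have ho : IsOpenEmbedding g := ⟨hg.isEmbedding, hgo⟩
  have h := hf.comp_openPartialHomeomorph (ho.toOpenPartialHomeomorph g) rfl
    (hg.contMDiff.contMDiffOn) (by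
      rw [IsOpenEmbedding.toOpenPartialHomeomorph_target]
      exact contMDiffOn_symm_of_isSmoothEmbedding hg ho)
  exact h

/-- The range of a composite with an open embedding in the middle is open when the outer map is
an open embedding. [folklore] -/
theorem isOpen_range_comp_of_isOpenEmbedding {X Y Z : Type*} [TopologicalSpace X]
    [TopologicalSpace Y] [TopologicalSpace Z] {f : Y → Z} {g : X → Y} (hf : IsOpenEmbedding f)
    (hg : IsOpen (range g)) : IsOpen (range (f ∘ g)) := by
  rw [range_comp]; exact hf.isOpenMap _ hg

end CompOpen

/-! ### The split presentation of a connected sum of disjoint unions -/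

section Presentation

variable {d : ℕ} (hd : d ≠ 0) {A A' B B' : Type u}
  [TopologicalSpace A] [T2Space A] [ChartedSpace (EuclideanSpace ℝ (Fin d)) A] [IsManifold (𝓡 d) ∞ A]
  [TopologicalSpace A'] [T2Space A'] [ChartedSpace (EuclideanSpace ℝ (Fin d)) A']
  [TopologicalSpace B] [T2Space B] [ChartedSpace (EuclideanSpace ℝ (Fin d)) B] [IsManifold (𝓡 d) ∞ B]
  [TopologicalSpace B'] [T2Space B'] [ChartedSpace (EuclideanSpace ℝ (Fin d)) B']
  (D : ConnectedSumData d A B)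

namespace ConnectedSumData

omit [T2Space B] [T2Space B'] in
/-- The first punctured piece of `(A' ⊔ A) # (B' ⊔ B)` is the image of `A' ⊔ (A ∖ {i₁ 0})`.
[folklore] -/
theorem coe_puncture_sumInr_i₁ :
    ((puncture (D.sumInr (A' := A') (B' := B')).i₁ : Opens (A' ⊕ A)) : Set (A' ⊕ A)) =
      range (Sum.map (id : A' → A') (Subtype.val : D.A → A)) := by
  ext p
  simp only [coe_puncture, mem_compl_iff, mem_singleton_iff, mem_range]
  constructor
  · intro hp
    rcases p with a' | a
    · exact ⟨Sum.inl a', rfl⟩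
    · exact ⟨Sum.inr ⟨a, fun h => hp (congrArg Sum.inr h)⟩, rfl⟩
  · rintro ⟨q, rfl⟩ h
    rcases q with a' | a
    · exact Sum.inl_ne_inr h
    · exact a.2 (Sum.inr_injective h)

omit [T2Space A] [T2Space A'] in
/-- The second punctured piece of `(A' ⊔ A) # (B' ⊔ B)` is the image of `B' ⊔ (B ∖ {i₂ 0})`.
[folklore] -/
theorem coe_puncture_sumInr_i₂ :
    ((puncture (D.sumInr (A' := A') (B' := B')).i₂ : Opens (B' ⊕ B)) : Set (B' ⊕ B)) =
      range (Sum.map (id : B' → B') (Subtype.val : D.B → B)) := by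
  ext p
  simp only [coe_puncture, mem_compl_iff, mem_singleton_iff, mem_range]
  constructor
  · intro hp
    rcases p with b' | b
    · exact ⟨Sum.inl b', rfl⟩
    · exact ⟨Sum.inr ⟨b, fun h => hp (congrArg Sum.inr h)⟩, rfl⟩
  · rintro ⟨q, rfl⟩ h
    rcases q with b' | b
    · exact Sum.inl_ne_inr h
    · exact b.2 (Sum.inr_injective h)

variable [IsManifold (𝓡 d) ∞ A'] [IsManifold (𝓡 d) ∞ B']

/-- The splitting `A' ⊔ (A ∖ {i₁ 0}) ≅ (A' ⊔ A) ∖ {inr (i₁ 0)}` of the first punctured piece.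
[folklore] -/
def splitA : (A' ⊕ D.A) ≃ₘ⟮𝓡 d, 𝓡 d⟯ ↥(puncture (D.sumInr (A' := A') (B' := B')).i₁) :=
  diffeomorphOntoOpens (Manifold.IsSmoothEmbedding.id.sumMap (Manifold.IsSmoothEmbedding.of_opens D.A))
    _ (D.coe_puncture_sumInr_i₁ (A' := A') (B' := B'))

/-- The splitting `B' ⊔ (B ∖ {i₂ 0}) ≅ (B' ⊔ B) ∖ {inr (i₂ 0)}` of the second punctured piece.
[folklore] -/
def splitB : (B' ⊕ D.B) ≃ₘ⟮𝓡 d, 𝓡 d⟯ ↥(puncture (D.sumInr (A' := A') (B' := B')).i₂) :=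
  diffeomorphOntoOpens (Manifold.IsSmoothEmbedding.id.sumMap (Manifold.IsSmoothEmbedding.of_opens D.B))
    _ (D.coe_puncture_sumInr_i₂ (A' := A') (B' := B'))

omit [IsManifold (𝓡 d) ∞ B'] in
omit [T2Space B] [T2Space B'] in
/-- `splitA` acts as `Sum.map id val`. [folklore] -/
@[simp] theorem coe_splitA (q : A' ⊕ D.A) :
    ((D.splitA (B' := B') q : ↥(puncture (D.sumInr (A' := A') (B' := B')).i₁)) : A' ⊕ A) =
      Sum.map id Subtype.val q := rfl

omit [IsManifold (𝓡 d) ∞ A'] in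
omit [T2Space A] [T2Space A'] in
/-- `splitB` acts as `Sum.map id val`. [folklore] -/
@[simp] theorem coe_splitB (q : B' ⊕ D.B) :
    ((D.splitB (A' := A') q : ↥(puncture (D.sumInr (A' := A') (B' := B')).i₂)) : B' ⊕ B) =
      Sum.map id Subtype.val q := rfl

omit [IsManifold (𝓡 d) ∞ B'] in
omit [T2Space B] [T2Space B'] in
/-- `Sum.map id val (splitA⁻¹ a) = a`. [folklore] -/
theorem sumMap_splitA_symm (a : ↥(puncture (D.sumInr (A' := A') (B' := B')).i₁)) :
    Sum.map id Subtype.val ((D.splitA (B' := B')).symm a) = (a : A' ⊕ A) := by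
  conv_rhs => rw [← (D.splitA (B' := B')).apply_symm_apply a]
  rfl

omit [IsManifold (𝓡 d) ∞ A'] in
omit [T2Space A] [T2Space A'] in
/-- `Sum.map id val (splitB⁻¹ b) = b`. [folklore] -/
theorem sumMap_splitB_symm (b : ↥(puncture (D.sumInr (A' := A') (B' := B')).i₂)) :
    Sum.map id Subtype.val ((D.splitB (A' := A')).symm b) = (b : B' ⊕ B) := by
  conv_rhs => rw [← (D.splitB (A' := A')).apply_symm_apply b]
  rfl

/-- The first gluing map of the split presentation: `A' ↦ inl (inl A')`, `A ∖ {i₁ 0} ↦ inr (jA _)`.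
[folklore] -/
def fA : A' ⊕ D.A → (A' ⊕ B') ⊕ D.Glued hd :=
  Sum.elim (Sum.inl ∘ Sum.inl) (Sum.inr ∘ (D.glueData hd).inl)

/-- The second gluing map of the split presentation: `B' ↦ inl (inr B')`,
`B ∖ {i₂ 0} ↦ inr (jB _)`. [folklore] -/
def fB : B' ⊕ D.B → (A' ⊕ B') ⊕ D.Glued hd :=
  Sum.elim (Sum.inl ∘ Sum.inr) (Sum.inr ∘ (D.glueData hd).inr)

/-- `inl ∘ inl` is a smooth embedding. [folklore] -/
theorem isSmoothEmbedding_inl_inl {X Y Z : Type u} [TopologicalSpace X] [TopologicalSpace Y]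
    [TopologicalSpace Z] [ChartedSpace (EuclideanSpace ℝ (Fin d)) X]
    [ChartedSpace (EuclideanSpace ℝ (Fin d)) Y] [ChartedSpace (EuclideanSpace ℝ (Fin d)) Z]
    [IsManifold (𝓡 d) ∞ X] [IsManifold (𝓡 d) ∞ Y] [IsManifold (𝓡 d) ∞ Z] :
    Manifold.IsSmoothEmbedding (𝓡 d) (𝓡 d) ∞ (Sum.inl ∘ Sum.inl : X → (X ⊕ Y) ⊕ Z) :=
  IsSmoothEmbedding.comp_of_isOpen_range Manifold.IsSmoothEmbedding.sumInl
    Manifold.IsSmoothEmbedding.sumInl isOpen_range_inl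

/-- `inl ∘ inr` is a smooth embedding. [folklore] -/
theorem isSmoothEmbedding_inl_inr {X Y Z : Type u} [TopologicalSpace X] [TopologicalSpace Y]
    [TopologicalSpace Z] [ChartedSpace (EuclideanSpace ℝ (Fin d)) X]
    [ChartedSpace (EuclideanSpace ℝ (Fin d)) Y] [ChartedSpace (EuclideanSpace ℝ (Fin d)) Z]
    [IsManifold (𝓡 d) ∞ X] [IsManifold (𝓡 d) ∞ Y] [IsManifold (𝓡 d) ∞ Z] :
    Manifold.IsSmoothEmbedding (𝓡 d) (𝓡 d) ∞ (Sum.inl ∘ Sum.inr : Y → (X ⊕ Y) ⊕ Z) :=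
  IsSmoothEmbedding.comp_of_isOpen_range Manifold.IsSmoothEmbedding.sumInl
    Manifold.IsSmoothEmbedding.sumInr isOpen_range_inr

omit [T2Space A'] [T2Space B'] in
/-- `fA` is a smooth embedding. [folklore] -/
theorem isSmoothEmbedding_fA :
    Manifold.IsSmoothEmbedding (𝓡 d) (𝓡 d) ∞ (D.fA hd (A' := A') (B' := B')) := by
  have h₁ : Manifold.IsSmoothEmbedding (𝓡 d) (𝓡 d) ∞ (Sum.inl ∘ Sum.inl : A' → (A' ⊕ B') ⊕ D.Glued hd) :=
    isSmoothEmbedding_inl_inl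
  have h₂ : Manifold.IsSmoothEmbedding (𝓡 d) (𝓡 d) ∞
      (Sum.inr ∘ (D.glueData hd).inl : D.A → (A' ⊕ B') ⊕ D.Glued hd) :=
    IsSmoothEmbedding.comp_of_isOpen_range Manifold.IsSmoothEmbedding.sumInr
      (D.glueData hd).isSmoothEmbedding_inl (D.glueData hd).isOpen_range_inl
  refine ⟨isImmersion_sumElim h₁.isImmersion h₂.isImmersion, ?_⟩
  refine (IsOpenEmbedding.of_continuous_injective_isOpenMap ?_ ?_ ?_).isEmbedding
  · exact h₁.isEmbedding.continuous.sumElim h₂.isEmbedding.continuous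
  · refine h₁.isEmbedding.injective.sumElim h₂.isEmbedding.injective fun a b hab => ?_
    exact Sum.inl_ne_inr hab
  · refine IsOpenMap.sumElim ?_ ?_
    · exact (IsOpenEmbedding.inl.comp IsOpenEmbedding.inl).isOpenMap
    · exact (IsOpenEmbedding.inr.comp ⟨(D.glueData hd).isSmoothEmbedding_inl.isEmbedding,
        (D.glueData hd).isOpen_range_inl⟩).isOpenMap

omit [T2Space A'] [T2Space B'] in
/-- `fB` is a smooth embedding. [folklore] -/
theorem isSmoothEmbedding_fB :
    Manifold.IsSmoothEmbedding (𝓡 d) (𝓡 d) ∞ (D.fB hd (A' := A') (B' := B')) := by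
  have h₁ : Manifold.IsSmoothEmbedding (𝓡 d) (𝓡 d) ∞ (Sum.inl ∘ Sum.inr : B' → (A' ⊕ B') ⊕ D.Glued hd) :=
    isSmoothEmbedding_inl_inr
  have h₂ : Manifold.IsSmoothEmbedding (𝓡 d) (𝓡 d) ∞
      (Sum.inr ∘ (D.glueData hd).inr : D.B → (A' ⊕ B') ⊕ D.Glued hd) :=
    IsSmoothEmbedding.comp_of_isOpen_range Manifold.IsSmoothEmbedding.sumInr
      (D.glueData hd).isSmoothEmbedding_inr (D.glueData hd).isOpen_range_inr
  refine ⟨isImmersion_sumElim h₁.isImmersion h₂.isImmersion, ?_⟩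
  refine (IsOpenEmbedding.of_continuous_injective_isOpenMap ?_ ?_ ?_).isEmbedding
  · exact h₁.isEmbedding.continuous.sumElim h₂.isEmbedding.continuous
  · refine h₁.isEmbedding.injective.sumElim h₂.isEmbedding.injective fun a b hab => ?_
    exact Sum.inl_ne_inr hab
  · refine IsOpenMap.sumElim ?_ ?_
    · exact (IsOpenEmbedding.inl.comp IsOpenEmbedding.inr).isOpenMap
    · exact (IsOpenEmbedding.inr.comp ⟨(D.glueData hd).isSmoothEmbedding_inr.isEmbedding,
        (D.glueData hd).isOpen_range_inr⟩).isOpenMap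

omit [IsManifold (𝓡 d) ∞ A] [TopologicalSpace A'] [T2Space A'] [ChartedSpace (EuclideanSpace ℝ (Fin d)) A'] [IsManifold (𝓡 d) ∞ B] [TopologicalSpace B'] [T2Space B'] [ChartedSpace (EuclideanSpace ℝ (Fin d)) B'] [IsManifold (𝓡 d) ∞ A'] [IsManifold (𝓡 d) ∞ B'] in
/-- The range of `fA`. [folklore] -/
theorem range_fA : range (D.fA hd (A' := A') (B' := B')) =
    range (Sum.inl ∘ Sum.inl : A' → (A' ⊕ B') ⊕ D.Glued hd) ∪
      Sum.inr '' range (D.glueData hd).inl := by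
  rw [fA, Set.Sum.elim_range, range_comp Sum.inr]

omit [IsManifold (𝓡 d) ∞ A] [TopologicalSpace A'] [T2Space A'] [ChartedSpace (EuclideanSpace ℝ (Fin d)) A'] [IsManifold (𝓡 d) ∞ B] [TopologicalSpace B'] [T2Space B'] [ChartedSpace (EuclideanSpace ℝ (Fin d)) B'] [IsManifold (𝓡 d) ∞ A'] [IsManifold (𝓡 d) ∞ B'] in
/-- The range of `fB`. [folklore] -/
theorem range_fB : range (D.fB hd (A' := A') (B' := B')) =
    range (Sum.inl ∘ Sum.inr : B' → (A' ⊕ B') ⊕ D.Glued hd) ∪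
      Sum.inr '' range (D.glueData hd).inr := by
  rw [fB, Set.Sum.elim_range, range_comp Sum.inr]

omit [IsManifold (𝓡 d) ∞ A] [T2Space A'] [ChartedSpace (EuclideanSpace ℝ (Fin d)) A'] [IsManifold (𝓡 d) ∞ B] [T2Space B'] [ChartedSpace (EuclideanSpace ℝ (Fin d)) B'] [IsManifold (𝓡 d) ∞ A'] [IsManifold (𝓡 d) ∞ B'] in
/-- The ranges of `fA`, `fB` are open. [folklore] -/
theorem isOpen_range_fA : IsOpen (range (D.fA hd (A' := A') (B' := B'))) := by
  rw [range_fA]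
  exact (isOpen_range_comp_of_isOpenEmbedding IsOpenEmbedding.inl isOpen_range_inl).union
    (IsOpenEmbedding.inr.isOpenMap _ (D.glueData hd).isOpen_range_inl)

omit [IsManifold (𝓡 d) ∞ A] [T2Space A'] [ChartedSpace (EuclideanSpace ℝ (Fin d)) A'] [IsManifold (𝓡 d) ∞ B] [T2Space B'] [ChartedSpace (EuclideanSpace ℝ (Fin d)) B'] [IsManifold (𝓡 d) ∞ A'] [IsManifold (𝓡 d) ∞ B'] in
/-- The ranges of `fA`, `fB` are open. [folklore] -/
theorem isOpen_range_fB : IsOpen (range (D.fB hd (A' := A') (B' := B'))) := by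
  rw [range_fB]
  exact (isOpen_range_comp_of_isOpenEmbedding IsOpenEmbedding.inl isOpen_range_inr).union
    (IsOpenEmbedding.inr.isOpenMap _ (D.glueData hd).isOpen_range_inr)

omit [IsManifold (𝓡 d) ∞ A] [TopologicalSpace A'] [T2Space A'] [ChartedSpace (EuclideanSpace ℝ (Fin d)) A'] [IsManifold (𝓡 d) ∞ B] [TopologicalSpace B'] [T2Space B'] [ChartedSpace (EuclideanSpace ℝ (Fin d)) B'] [IsManifold (𝓡 d) ∞ A'] [IsManifold (𝓡 d) ∞ B'] in
/-- The ranges of `fA`, `fB` cover. [folklore] -/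
theorem range_fA_union_range_fB :
    range (D.fA hd (A' := A') (B' := B')) ∪ range (D.fB hd (A' := A') (B' := B')) = univ := by
  apply eq_univ_of_forall
  rintro ((a' | b') | c)
  · exact Or.inl ⟨Sum.inl a', rfl⟩
  · exact Or.inr ⟨Sum.inl b', rfl⟩
  · rcases (eq_univ_iff_forall.1 (D.glueData hd).range_inl_union_range_inr c) with ⟨q, rfl⟩ | ⟨r, rfl⟩
    · exact Or.inl ⟨Sum.inr q, rfl⟩
    · exact Or.inr ⟨Sum.inr r, rfl⟩

omit [IsManifold (𝓡 d) ∞ A] [TopologicalSpace A'] [T2Space A'] [ChartedSpace (EuclideanSpace ℝ (Fin d)) A'] [IsManifold (𝓡 d) ∞ B] [TopologicalSpace B'] [T2Space B'] [ChartedSpace (EuclideanSpace ℝ (Fin d)) B'] [IsManifold (𝓡 d) ∞ A'] [IsManifold (𝓡 d) ∞ B'] in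
/-- The identifications of `fA`, `fB` are Kervaire–Milnor's relation of the discs of `A`, `B`.
[folklore] -/
theorem fA_eq_fB_iff (q : A' ⊕ D.A) (r : B' ⊕ D.B) :
    D.fA hd (A' := A') (B' := B') q = D.fB hd r ↔
      ∃ (a : D.A) (b : D.B), q = Sum.inr a ∧ r = Sum.inr b ∧ connectedSumRel D.i₁ D.i₂ a b := by
  rcases q with a' | a <;> rcases r with b' | b
  · simp only [fA, fB, Sum.elim_inl, comp_apply, Sum.inl.injEq, reduceCtorEq, false_and,
      exists_false]
  · simp [fA, fB]
  · simp [fA, fB]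
  · simp only [fA, fB, Sum.elim_inr, comp_apply, Sum.inr.injEq, exists_and_left,
      exists_eq_left', D.inl_eq_inr_iff_connectedSumRel hd]

omit [IsManifold (𝓡 d) ∞ A'] [IsManifold (𝓡 d) ∞ B'] in
/-- Kervaire–Milnor's relation for the lifted discs is the relation for the discs of `A`, `B`,
read on the top copies. [folklore] -/
theorem connectedSumRel_sumInr_iff (a : ↥(puncture (D.sumInr (A' := A') (B' := B')).i₁))
    (b : ↥(puncture (D.sumInr (A' := A') (B' := B')).i₂)) :
    connectedSumRel (D.sumInr (A' := A') (B' := B')).i₁ (D.sumInr (A' := A') (B' := B')).i₂ a b ↔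
      ∃ (a₀ : D.A) (b₀ : D.B), (a : A' ⊕ A) = Sum.inr a₀.1 ∧ (b : B' ⊕ B) = Sum.inr b₀.1 ∧
        connectedSumRel D.i₁ D.i₂ a₀ b₀ := by
  constructor
  · rintro ⟨u, t, hu, ht, ha, hb⟩
    have ha' : (a : A' ⊕ A) = Sum.inr (D.i₁ (t • u)) := ha
    have hb' : (b : B' ⊕ B) = Sum.inr (D.i₂ ((1 - t) • u)) := hb
    have ha₀ : D.i₁ (t • u) ∈ D.A := by
      rw [mem_puncture]
      intro h
      have := D.isSmoothEmbedding_i₁.isEmbedding.injective h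
      rw [smul_eq_zero] at this
      rcases this with h1 | h1
      · exact (ne_of_gt ht.1) h1
      · rw [h1, norm_zero] at hu; exact zero_ne_one hu
    have hb₀ : D.i₂ ((1 - t) • u) ∈ D.B := by
      rw [mem_puncture]
      intro h
      have := D.isSmoothEmbedding_i₂.isEmbedding.injective h
      rw [smul_eq_zero] at this
      rcases this with h1 | h1
      · exact (ne_of_gt (sub_pos.2 ht.2)) h1
      · rw [h1, norm_zero] at hu; exact zero_ne_one hu
    exact ⟨⟨_, ha₀⟩, ⟨_, hb₀⟩, ha', hb', u, t, hu, ht, rfl, rfl⟩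
  · rintro ⟨a₀, b₀, ha, hb, u, t, hu, ht, ha₀, hb₀⟩
    refine ⟨u, t, hu, ht, ?_, ?_⟩
    · show (a : A' ⊕ A) = Sum.inr (D.i₁ (t • u))
      rw [ha, ha₀]
    · show (b : B' ⊕ B) = Sum.inr (D.i₂ ((1 - t) • u))
      rw [hb, hb₀]

omit [IsManifold (𝓡 d) ∞ B'] in
omit [T2Space B] [T2Space B'] in
/-- `splitA⁻¹ a = inr a₀` exactly when `a` is the point `inr a₀` of the top copy. [folklore] -/
theorem splitA_symm_eq_inr_iff (a : ↥(puncture (D.sumInr (A' := A') (B' := B')).i₁)) (a₀ : D.A) :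
    (D.splitA (B' := B')).symm a = Sum.inr a₀ ↔ (a : A' ⊕ A) = Sum.inr a₀.1 := by
  have key := D.sumMap_splitA_symm (B' := B') a
  constructor
  · intro h
    rw [h] at key
    exact key.symm
  · intro h
    rw [h] at key
    rcases hq : (D.splitA (B' := B')).symm a with a' | q
    · rw [hq] at key; exact absurd key Sum.inl_ne_inr
    · rw [hq] at key
      simp only [Sum.map_inr, Sum.inr.injEq] at key
      rw [Subtype.ext key]

omit [IsManifold (𝓡 d) ∞ A'] in
omit [T2Space A] [T2Space A'] in
/-- `splitB⁻¹ b = inr b₀` exactly when `b` is the point `inr b₀` of the top copy. [folklore] -/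
theorem splitB_symm_eq_inr_iff (b : ↥(puncture (D.sumInr (A' := A') (B' := B')).i₂)) (b₀ : D.B) :
    (D.splitB (A' := A')).symm b = Sum.inr b₀ ↔ (b : B' ⊕ B) = Sum.inr b₀.1 := by
  have key := D.sumMap_splitB_symm (A' := A') b
  constructor
  · intro h
    rw [h] at key
    exact key.symm
  · intro h
    rw [h] at key
    rcases hq : (D.splitB (A' := A')).symm b with b' | q
    · rw [hq] at key; exact absurd key Sum.inl_ne_inr
    · rw [hq] at key
      simp only [Sum.map_inr, Sum.inr.injEq] at key
      rw [Subtype.ext key]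

/-- **The split presentation realises Kervaire–Milnor's relation of the lifted discs**: the
gluing maps `fA ∘ splitA⁻¹`, `fB ∘ splitB⁻¹` of `(A' ⊔ B') ⊔ (A # B)` identify exactly the
pairs related by `connectedSumRel (inr ∘ i₁) (inr ∘ i₂)`. [cite: KervaireMilnor1963, §2] -/
theorem fA_splitA_symm_eq_iff (a : ↥(puncture (D.sumInr (A' := A') (B' := B')).i₁))
    (b : ↥(puncture (D.sumInr (A' := A') (B' := B')).i₂)) :
    D.fA hd ((D.splitA (B' := B')).symm a) = D.fB hd ((D.splitB (A' := A')).symm b) ↔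
      connectedSumRel (D.sumInr (A' := A') (B' := B')).i₁ (D.sumInr (A' := A') (B' := B')).i₂ a b := by
  rw [fA_eq_fB_iff, connectedSumRel_sumInr_iff]
  constructor
  · rintro ⟨a₀, b₀, ha, hb, h⟩
    exact ⟨a₀, b₀, (D.splitA_symm_eq_inr_iff a a₀).1 ha, (D.splitB_symm_eq_inr_iff b b₀).1 hb, h⟩
  · rintro ⟨a₀, b₀, ha, hb, h⟩
    exact ⟨a₀, b₀, (D.splitA_symm_eq_inr_iff a a₀).2 ha, (D.splitB_symm_eq_inr_iff b b₀).2 hb, h⟩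

end ConnectedSumData

end Presentation

/-! ### Merging two closed manifolds: `A ⊔ B` is cobordant to `A # B` -/

section Merging

variable {n : ℕ} {A B : Type} [TopologicalSpace A] [T2Space A] [SecondCountableTopology A]
  [ChartedSpace (EuclideanSpace ℝ (Fin (n + 1))) A] [IsManifold (𝓡 (n + 1)) ∞ A] [CompactSpace A]
  [TopologicalSpace B] [T2Space B] [SecondCountableTopology B]
  [ChartedSpace (EuclideanSpace ℝ (Fin (n + 1))) B] [IsManifold (𝓡 (n + 1)) ∞ B] [CompactSpace B]

/-- **The double `A ⊔ A` bounds the cylinder `A × [0, 1]`** as a cobordism to the empty manifold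
(Milnor 1965, §1; Thom 1954, Ch. IV §1: `V + V ≃ 0`): the tree's `cylinderCobordism` read through
`IsCobordant.sum_of_isEmpty`. [cite: ThomCMH1954, Ch. IV §1 p. 64] -/
theorem isCobordant_sum_self_of_isEmpty (E : Type) [TopologicalSpace E]
    [ChartedSpace (EuclideanSpace ℝ (Fin (n + 1))) E] [IsEmpty E] : IsCobordant (n + 1) (A ⊕ A) E :=
  (show IsCobordant (n + 1) A A from isCobordant_refl_holds).sum_of_isEmpty

/-- **Merging lemma (unoriented): the disjoint union of two closed manifolds is cobordant to a
connected closed manifold** — namely to the connected sum `A # B`, through the boundary connected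
sum `(A × I) ♮ (B × I)` of the two cylinders taken at discs of the top copies `A × 1`, `B × 1`
(equivalently `(A ⊔ B) × I` with a `1`-handle; Kirby 1989, Ch. VIII; Milnor–Stasheff 1974, §17;
Kervaire–Milnor 1963, §2 Lemma 2.2 for the boundary connected sum): its boundary is
`(A ⊔ A) # (B ⊔ B) ≅ (A ⊔ B) ⊔ (A # B)` (the split presentation, by uniqueness of open gluings),
so `(A ⊔ B) ⊔ (A # B)` bounds, i.e. `A ⊔ B ∼ A # B` (Thom's dictionary,
`IsCobordant.of_sum_of_isEmpty`), and `A # B` is connected in dimension `n + 1 ≥ 2`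
(`IsConnectedSum.connectedSpace_holds`).  Closed manifolds in `Type`, nonempty and connected.
[cite: Kirby1989, Ch. VIII (with Cor. IX.2)] -/
theorem exists_isCobordant_sum_connectedSpace [Nonempty A] [Nonempty B] [ConnectedSpace A]
    [ConnectedSpace B] (hn : 1 ≤ n) :
    ∃ (C : Type) (_ : TopologicalSpace C) (_ : T2Space C) (_ : SecondCountableTopology C)
      (_ : ChartedSpace (EuclideanSpace ℝ (Fin (n + 1))) C) (_ : IsManifold (𝓡 (n + 1)) ∞ C)
      (_ : CompactSpace C) (_ : ConnectedSpace C), IsCobordant (n + 1) (A ⊕ B) C := by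
  classical
  letI : ChartedSpace (EuclideanSpace ℝ (Fin (n + 1))) PEmpty.{1} := ChartedSpace.empty _ _
  have hd : n + 1 ≠ 0 := Nat.succ_ne_zero n
  -- the cylinders as null-cobordisms of the doubles
  obtain ⟨cA⟩ := isCobordant_sum_self_of_isEmpty (n := n) (A := A) PEmpty.{1}
  obtain ⟨cB⟩ := isCobordant_sum_self_of_isEmpty (n := n) (A := B) PEmpty.{1}
  let cS : NullCobordism (n + 1) (A ⊕ A) := NullCobordism.ofCobordism cA
  let cT : NullCobordism (n + 1) (B ⊕ B) := NullCobordism.ofCobordism cB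
  -- discs of `A`, `B`, lifted to the top copies
  obtain ⟨D⟩ := nonempty_connectedSumData (n := n + 1) (M := A) (N := B)
  set Dσ : ConnectedSumData (n + 1) (A ⊕ A) (B ⊕ B) := D.sumInr (A' := A) (B' := B) with hDσ
  have hiS : Manifold.IsSmoothEmbedding (𝓡 (n + 1)) (𝓡 (n + 1)) ∞ Dσ.i₁ := Dσ.isSmoothEmbedding_i₁
  have hiT : Manifold.IsSmoothEmbedding (𝓡 (n + 1)) (𝓡 (n + 1)) ∞ Dσ.i₂ := Dσ.isSmoothEmbedding_i₂
  -- collars and the boundary connected sum of the cylinders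
  obtain ⟨κS⟩ := BoundaryData.nonempty_collar_of_compactSpace n cS.W cS.boundaryData
  obtain ⟨κT⟩ := BoundaryData.nonempty_collar_of_compactSpace n cT.W cT.boundaryData
  have hkS := κS.isSmoothEmbedding_halfDisc hiS (isOpen_range_of_isSmoothEmbedding_disc hiS)
  have hkT := κT.isSmoothEmbedding_halfDisc hiT (isOpen_range_of_isSmoothEmbedding_disc hiT)
  obtain ⟨P, _, _, _, _, _, hglue⟩ :=
    (HalfDiscPair.mk (κS.halfDisc Dσ.i₁) (κT.halfDisc Dσ.i₂) hkS.1 hkS.2 hkT.1 hkT.2).exists_isOpenGluing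
  haveI : CompactSpace P := compactSpace_of_isOpenGluing_boundaryConnectedSumRel_holds (n + 2) cS.W
    cT.W P _ _ hkS.1 hkS.2 hkT.1 hkT.2 hglue
  obtain ⟨W⟩ := HalfGluing.nonempty_of_isOpenGluing hglue
  -- the glued boundary `(A ⊔ A) # (B ⊔ B)` bounds
  let X : NullCobordism.BCSSetup n :=
    { MS := A ⊕ A
      MT := B ⊕ B
      MU := Dσ.Glued hd
      cS := cS
      cT := cT
      κS := κS
      κT := κT
      iS := Dσ.i₁
      iT := Dσ.i₂
      hiS := hiS
      hiT := hiT
      P := P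
      W := W
      Dσ := Dσ
      hD₁ := rfl
      hD₂ := rfl
      jA := (Dσ.glueData hd).inl
      jB := (Dσ.glueData hd).inr
      hjA := (Dσ.glueData hd).isSmoothEmbedding_inl
      hjAo := (Dσ.glueData hd).isOpen_range_inl
      hjB := (Dσ.glueData hd).isSmoothEmbedding_inr
      hjBo := (Dσ.glueData hd).isOpen_range_inr
      Ψ := Diffeomorph.refl _ _ _
      hΨA := fun a => rfl
      hΨB := fun b => rfl }
  -- `(A ⊔ A) # (B ⊔ B) ≅ (A ⊔ B) ⊔ (A # B)`
  have hA' := (D.isSmoothEmbedding_fA hd (A' := A) (B' := B)).comp_diffeomorph (D.splitA (B' := B)).symm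
  have hB' := (D.isSmoothEmbedding_fB hd (A' := A) (B' := B)).comp_diffeomorph (D.splitB (A' := A)).symm
  have hrA : range (D.fA hd (A' := A) (B' := B) ∘ (D.splitA (B' := B)).symm) = range (D.fA hd) :=
    (D.splitA (B' := B)).symm.surjective.range_comp _
  have hrB : range (D.fB hd (A' := A) (B' := B) ∘ (D.splitB (A' := A)).symm) = range (D.fB hd) :=
    (D.splitB (A' := A)).symm.surjective.range_comp _
  obtain ⟨Φ, -, -⟩ := IsOpenGluing.exists_diffeomorph_comp_eq (IP := 𝓡 (n + 1)) (IP' := 𝓡 (n + 1))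
    (P := Dσ.Glued hd) (P' := (A ⊕ B) ⊕ D.Glued hd)
    (Dσ.glueData hd).isSmoothEmbedding_inl (Dσ.glueData hd).isOpen_range_inl
    (Dσ.glueData hd).isSmoothEmbedding_inr (Dσ.glueData hd).isOpen_range_inr
    (Dσ.glueData hd).range_inl_union_range_inr (fun a b => Dσ.inl_eq_inr_iff_connectedSumRel hd a b)
    hA' (hrA ▸ D.isOpen_range_fA hd) hB' (hrB ▸ D.isOpen_range_fB hd)
    (by rw [hrA, hrB]; exact D.range_fA_union_range_fB hd) (fun a b => D.fA_splitA_symm_eq_iff hd a b)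
  have h₁ : IsCobordant (n + 1) ((A ⊕ B) ⊕ D.Glued hd) PEmpty.{1} :=
    ⟨(X.glued.toCobordism PEmpty.{1}).compDiffeomorphLeft Φ.symm⟩
  -- dictionary and connectedness of `A # B`
  have h₂ : IsCobordant (n + 1) (A ⊕ B) (D.Glued hd) := IsCobordant.of_sum_of_isEmpty h₁
  haveI : ConnectedSpace (D.Glued hd) :=
    IsConnectedSum.connectedSpace_holds (by rw [finrank_euclideanSpace_fin]; omega)
      (D.isConnectedSum_glued hd)
  exact ⟨D.Glued hd, inferInstance, inferInstance, inferInstance, inferInstance, inferInstance,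
    inferInstance, inferInstance, h₂⟩

/-! ### Every closed manifold is cobordant to a connected one -/

section Representative

/-- **Every (unoriented) bordism class of positive dimension `n + 1 ≥ 2` has a connected
representative**: a closed smooth nonempty manifold `M : Type` is cobordant to a connected closed
one (Thom 1954, Ch. IV §1: the classes of `𝔑` under `⊔`; Milnor–Stasheff 1974, §17), by induction
on the number of components — split off a component (`exists_opens_isCompl_connectedSpace`,
`exists_diffeomorph_sum_of_isCompl`), replace the rest by a connected representative
(`IsCobordant.sum` with a cylinder, `IsCobordant.trans_succ`), and merge
(`exists_isCobordant_sum_connectedSpace`). [cite: ThomCMH1954, Ch. IV §1 p. 64] -/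
theorem exists_connectedSpace_isCobordant (hn : 1 ≤ n) (M : Type) [TopologicalSpace M] [T2Space M]
    [SecondCountableTopology M] [ChartedSpace (EuclideanSpace ℝ (Fin (n + 1))) M]
    [IsManifold (𝓡 (n + 1)) ∞ M] [CompactSpace M] [Nonempty M] :
    ∃ (C : Type) (_ : TopologicalSpace C) (_ : T2Space C) (_ : SecondCountableTopology C)
      (_ : ChartedSpace (EuclideanSpace ℝ (Fin (n + 1))) C) (_ : IsManifold (𝓡 (n + 1)) ∞ C)
      (_ : CompactSpace C) (_ : ConnectedSpace C), IsCobordant (n + 1) M C := by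
  suffices H : ∀ (m : ℕ) (M : Type) [TopologicalSpace M] [T2Space M] [SecondCountableTopology M]
      [ChartedSpace (EuclideanSpace ℝ (Fin (n + 1))) M] [IsManifold (𝓡 (n + 1)) ∞ M]
      [CompactSpace M] [Nonempty M], Nat.card (ConnectedComponents M) = m →
      ∃ (C : Type) (_ : TopologicalSpace C) (_ : T2Space C) (_ : SecondCountableTopology C)
        (_ : ChartedSpace (EuclideanSpace ℝ (Fin (n + 1))) C) (_ : IsManifold (𝓡 (n + 1)) ∞ C)
        (_ : CompactSpace C) (_ : ConnectedSpace C), IsCobordant (n + 1) M C from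
    H _ M rfl
  intro m
  induction m using Nat.strong_induction_on with
  | _ m ih => ?_
  intro M _ _ _ _ _ _ _ hm
  haveI : LocallyConnectedSpace M :=
    ChartedSpace.locallyConnectedSpace (EuclideanSpace ℝ (Fin (n + 1))) M
  by_cases hc : ConnectedSpace M
  · exact ⟨M, inferInstance, inferInstance, inferInstance, inferInstance, inferInstance,
      inferInstance, hc, show IsCobordant (n + 1) M M from isCobordant_refl_holds⟩
  obtain ⟨U, V, hUV, hU, hV, hlt⟩ := exists_opens_isCompl_connectedSpace (M := M) hc
  have hUc : IsClosed (U : Set M) := by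
    rw [← hUV.symm.compl_eq]
    exact V.isOpen.isClosed_compl
  have hVc : IsClosed (V : Set M) := by
    rw [← hUV.compl_eq]
    exact U.isOpen.isClosed_compl
  haveI : CompactSpace U := isCompact_iff_compactSpace.1 hUc.isCompact
  haveI : CompactSpace V := isCompact_iff_compactSpace.1 hVc.isCompact
  haveI : Nonempty U := hU.toNonempty
  obtain ⟨φ, -⟩ := exists_diffeomorph_sum_of_isCompl (k := n + 1) U V hUV
  -- a connected representative of `V`, by induction; merge it with the component `U`
  obtain ⟨C', _, _, _, _, _, _, _, hC'⟩ := ih _ (hm ▸ hlt) V rfl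
  obtain ⟨C, _, _, _, _, _, _, _, hC⟩ := exists_isCobordant_sum_connectedSpace (A := U) (B := C') hn
  have h1 : IsCobordant (n + 1) (U ⊕ V) (U ⊕ C') :=
    (show IsCobordant (n + 1) U U from isCobordant_refl_holds).sum hC'
  have h2 : IsCobordant (n + 1) M (U ⊕ V) := by
    obtain ⟨c⟩ := (show IsCobordant (n + 1) (U ⊕ V) (U ⊕ V) from isCobordant_refl_holds)
    exact ⟨c.compDiffeomorphLeft φ.symm⟩
  exact ⟨C, inferInstance, inferInstance, inferInstance, inferInstance, inferInstance,
    inferInstance, inferInstance, (h2.trans_succ h1).trans_succ hC⟩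

end Representative

end Merging


end Literature.Topology.FourManifolds
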